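import Mathlib

/-!
# Dimock, *The renormalization group according to Balaban* II (large fields), §3.16 "the RG flow": «the coupling
# constant flow follows the global analysis of part I, even though the effective action is localized» — the LOCALIZED
# extraction (renorm2)–(renorm5) `E(Λ) = −ε(E)Vol(Λ) − ½μ(E)‖φ‖²_Λ + Σ_{X⊂Λ}(𝓡E)(X) + boundary terms 𝒯_Λ E(X), X # Λ`,
# PROVED as a resummation identity over polymers inside a region

**Citation header (reproduction of PUBLISHED work; template of the Bałaban lattice Yang–Mills cell).**
J. Dimock, *The renormalization group according to Balaban II. Large fields*, J. Math. Phys. **54** (2013) 092301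
(= arXiv:1212.5562v2) [Dimock2013BalabanII], §3.16 `\subsection{the RG flow}` TeX L5816–5976: the setting L5818–5826,
(renorm) L5828–5843, (renorm2) L5849–5866, «well inside» L5868–5875, (renorm3) L5876–5886, the boundary-term identities
L5887–5909, `𝒯_Λ E(X)` L5910–5915, (renorm5) L5916–5921; §3.1 L1756–1761 for `X # Λ`.  TeX line numbers refer to the
arXiv source held by the cell on this hub at `run/shared/lean/archive/nearmiss/qft-balaban/dimock/src/1212.5562/
1212.5562.tex` (7217 lines, sha256[:16] 75c5792fc48eacbc); every quotation below was read there this session.  Dimock's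
papers are published and refereed and are the cell's TEMPLATE, not manuscripts under audit; no quantity of the
Bałaban series is touched.  The GLOBAL extraction (renorm)∕(renorm2) of part I ([Dimock2013] §3.5) is the sibling
`NormalizationExtraction` (v8.6x); this leaf is the REGION-RELATIVE bookkeeping that part II adds.

**What the paper prints (verbatim; `…` marks an elision).**  L5818–5826: *"Now we show that the coupling constant flow
follows the global analysis of part I, even though the effective action is localized. … First consider a more
general case. Let Λ ⊂ 𝕋^{−k−1}_{𝖬+𝖭−k−1}, and φ : Λ → ℝ, and suppose E(Λ) = Σ_{X⊂Λ} E(X) with E(X, φ) translation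
invariant."*  L5846–5866: *"Summing this over X ⊂ Λ we find  E(Λ) = −Σ_{□⊂Λ} ε_Λ(E,□)Vol(□) − ½Σ_{□⊂Λ} μ_Λ(E,□)‖φ‖²_□ −
Σ_μΣ_{□⊂Λ} ν_{Λ,μ}(E,□)∫_□ φ∂_μφ + Σ_{X⊂Λ}(𝓡E)(X)  (renorm2)  where  ε_Λ(E,□) = −Σ_{□⊂X⊂Λ, X∈𝒮} α(E,X)   ½μ_Λ(E,□) =
−Σ_{□⊂X⊂Λ, X∈𝒮} α_2(E,X)   ν_{Λ,μ}(E,□) = −Σ_{□⊂X⊂Λ, X∈𝒮} α_{2,μ}(E,X)"*.  L5868–5875: *"Now if □ is well inside Λ then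
X ∈ 𝒮 and X ⊃ □ imply X ⊂ Λ so we can drop the latter condition from the sums. Then ε_Λ(E,□), μ_Λ(E,□), ν_{Λ,μ}(E,□)
are independent of □ and Λ and agree with the global quantities which are denoted ε(E), μ(E), ν_μ(E). Furthermore
the lattice symmetries imply that ν_μ(E) = 0."*  L5887–5898: *"The last three terms can be treated as boundary
terms. Indeed we have  Σ_{□⊂Λ}(ε_Λ(E,□) − ε(E))Vol(□) = Σ_{□⊂Λ}(Σ_{X∈𝒮, X⊃□, X#Λ} α_0(E,X))Vol(□) = Σ_{X∈𝒮, X#Λ}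
α_0(E,X)(Σ_{□⊂Λ∩X} Vol(□)) = Σ_{X∈𝒮, X#Λ} α_0(E,X)Vol(Λ ∩ X)"*.  L5910–5921: *"we combine the last three terms
defining for X ∈ 𝒮 only  𝒯_Λ E(X, φ) = α_0(E,X)Vol(Λ ∩ X) + α_2(E,X)‖φ‖²_{X∩Λ} + Σ_μ α_{2,μ}(E,X)∫_{X∩Λ} φ ∂_μφ  Now
(renorm3) becomes  E(Λ) = −ε(E)Vol(Λ) − ½μ(E)‖φ‖²_Λ + Σ_{X⊂Λ}(𝓡E)(X) + Σ_{X#Λ, X∈𝒮} 𝒯_Λ E(X)  (renorm5)"*.  L1758–1760: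
*"X # Λ means X crosses Λ or  X # Λ ⟺ X ∩ Λ ≠ ∅ and X ∩ Λ^c ≠ ∅"*.

**What is reproduced here (kernel-checked, zero `sorry`; imports Mathlib only).**  Finite combinatorics: cubes `C`
(`DecidableEq`), polymers `X : Finset C`, the small polymers `𝒮 : Finset (Finset C)`, a region `Λ : Finset C`,
coefficients `α : Finset C → R` in a commutative ring (print: `α_0(E,·)`, `α_2(E,·)`, `α_{2,μ}(E,·)` at a fixed
field), and cube functionals `v : C → R` ADDITIVE over polymers (`addV v X = Σ_{□∈X} v □`; print: `Vol`, `‖φ‖²_X`,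
`∫_X φ∂_μφ`).
* §1 `addV`, **`Crosses X Λ`** (`X # Λ`, decidable), **`locCoeff 𝒮 α Λ □ = Σ_{X∈𝒮, □∈X⊆Λ} α X`** (= `−ε_Λ(E,□)`,
  `−½μ_Λ(E,□)`, `−ν_{Λ,μ}(E,□)`), **`globCoeff 𝒮 α □ = Σ_{X∈𝒮, □∈X} α X`** (= `−ε(E)` etc., the part-I quantities);
* §2 **`sum_small_inside_eq`** = (renorm2): `Σ_{X∈𝒮, X⊆Λ} α(X)·V(X) = Σ_{□∈Λ} locCoeff(□)·v(□)`;
  **`locCoeff_eq_globCoeff_of_wellInside`** (*"if □ is well inside Λ … we can drop the latter condition"*);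
  **`globCoeff_sub_locCoeff`** (`= Σ_{X∈𝒮, □∈X, X⊄Λ} α X`); **`sum_sub_mul_eq_sum_crosses`** = the boundary identity
  L5887–5898 (`Σ_{□∈Λ}(glob − loc)(□)·v(□) = Σ_{X∈𝒮, X#Λ} α(X)·V(X ∩ Λ)`, exchanging the sums and dropping the `X` with
  `X ∩ Λ = ∅`); **`sum_small_inside_eq_global_sub_bdry`** = (renorm3)∕(renorm5) for one relevant part:
  `Σ_{X∈𝒮, X⊆Λ} α(X)·V(X) = Σ_{□∈Λ} glob(□)·v(□) − Σ_{X#Λ} α(X)·V(X∩Λ)`; **`sum_globCoeff_mul_of_const`** (translation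
  invariance: `glob(□) = g` on `Λ` ⟹ `= g·V(Λ)`);
* §3 **`localized_extraction`**: for `E(X) = Σ_i α_i(X)·V_i(X) + 𝓡E(X)` on small `X` and `E(X) = 𝓡E(X)` on large `X`
  (finitely many relevant parts `i`), `Σ_{X⊆Λ} E(X) = Σ_i Σ_{□∈Λ} glob_i(□)·v_i(□) + Σ_{X⊆Λ} 𝓡E(X) − Σ_i Σ_{X∈𝒮, X#Λ}
  α_i(X)·V_i(X∩Λ)`, and **`localized_extraction_of_const`** (translation-invariant case: `= Σ_i g_i·V_i(Λ) + Σ 𝓡E −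
  Σ_{X#Λ} 𝒯_Λ E(X)` with **`bdryT`** `= 𝒯_Λ E(X) = Σ_i α_i(X)·V_i(X ∩ Λ)` as printed);
* §4 a non-vacuity `example`.

**Readings ∕ located items (declared).**  (i) The relevant parts are indexed by a finite type (print: `0`, `2`, `(2,μ)`);
the field is fixed, so `Vol(X)`, `‖φ‖²_X`, `∫_Xφ∂_μφ` are just additive polymer functionals `V_i`; `𝓡E` is any
polymer function (its normalization is the sibling `NormalizationExtraction.isNormalized_renorm`).  (ii) «well
inside» is rendered as the hypothesis `∀ X ∈ 𝒮, □ ∈ X → X ⊆ Λ`; translation invariance as the hypothesis `glob_i(□)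
= g_i` for `□ ∈ Λ` (print: `g_0 = −ε(E)`, `g_2 = −½μ(E)`, `g_{2,μ} = −ν_μ(E) = 0`).  (iii) SIGN BOOKKEEPING (INFO,
records only): with `ε_Λ`, `ε` as printed (L5862, part I L1811) one has `ε_Λ(E,□) − ε(E) = +Σ_{X∈𝒮, X∋□, X#Λ} α_0(E,X)`
(as the display L5889–5891 prints), so (renorm3)'s `−Σ_□(ε_Λ(E,□) − ε(E))Vol(□)` equals `−Σ_{X#Λ} α_0(E,X)Vol(Λ∩X)`:
the identity holds with `… − Σ_{X#Λ, X∈𝒮} 𝒯_Λ E(X)` for `𝒯_Λ` as defined at L5911–5915 (this file's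
`localized_extraction_of_const`), where (renorm5) L5918–5921 prints `+`; likewise (renorm3)'s third line prints `+Σ_μΣ_□
(ν_{Λ,μ} − ν_μ)∫_□φ∂_μφ` where (renorm2)'s `−Σ_μΣ_□ ν_{Λ,μ}…` gives `−`.  Downstream ((nugatory) L5966–5976, §3.17) the
`𝒯_Λ` terms are carried as boundary terms and bounded in absolute value, so the overall sign is immaterial; recorded,
not adjudicated further.

**What is NOT claimed.**  The bounds on `𝒯_Λ E` and its absorption into the boundary terms (§3.17), Lemma `study`'s
bounds on `ε(E)`, `μ(E)`, the lattice-symmetry facts (`□`-independence, `ν_μ = 0` — hypotheses here; the part-I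
versions are kernel in `NormalizationExtraction.renorm2`), the flow equations (recursive) themselves (kernel as
DEFINITIONS in `SmallFieldStepAssembly`), anything of B1–B16 (TEMPLATE.md §4.2 row «D2 §3.15–3.16» ↔ B14 §3 ∕ B12
(0.18)–(0.20): grade P, «in d = 4 the flow itself is the unproved leaf» — untouched).  NOT summit progress; NOT a
statement about any Bałaban paper; NOT continuum; NOT Clay.  NEW leaf; imports Mathlib only; no Summits import;
sub-namespace `…Dimock2011to13.LocalizedExtraction`; modifies nothing.  Unit `b2b-balaban-template` gen 35 (journal
CLAIM D2-RGFLOW-LOCAL); cell records TEMPLATE.md §4.2 row «D2 §3.15–3.16» (FIRST kernel entry), GAPS C-tmpl35-6.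
-/

open Finset
open scoped BigOperators

namespace Literature.MathematicalPhysics.QuantumFieldTheory.Dimock2011to13.LocalizedExtraction

variable {C : Type*} [DecidableEq C] {R : Type*} [CommRing R]

/-! ## §1 The objects: additive polymer functionals, `X # Λ`, the local and the global coefficients -/

/-- An ADDITIVE polymer functional built from a cube functional: `V(X) = Σ_{□∈X} v(□)` (print: `Vol(X) = Σ_{□⊂X}
Vol(□)`, `‖φ‖²_X`, `∫_X φ∂_μφ`). [cite: Dimock2013BalabanII, §3.16 (arXiv:1212.5562v2 TeX L5887–5898)] -/
def addV (v : C → R) (X : Finset C) : R := ∑ b ∈ X, v b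

/-- **`X # Λ`** — *"X # Λ means X crosses Λ or X # Λ ⟺ X ∩ Λ ≠ ∅ and X ∩ Λ^c ≠ ∅"*. [cite: Dimock2013BalabanII, §3.1 (arXiv:1212.5562v2 TeX L1756–1761)] -/
def Crosses (X Λ : Finset C) : Prop := (X ∩ Λ).Nonempty ∧ ¬ X ⊆ Λ

/-- `X # Λ` is decidable (plumbing). [folklore] -/
instance instDecidableCrosses (X Λ : Finset C) : Decidable (Crosses X Λ) := by
  unfold Crosses; exact inferInstance

/-- **The local coefficient at a cube**: `Σ_{□⊂X⊂Λ, X∈𝒮} α(E,X)` (= `−ε_Λ(E,□)`, `−½μ_Λ(E,□)`, `−ν_{Λ,μ}(E,□)` for `α =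
α_0, α_2, α_{2,μ}`). [cite: Dimock2013BalabanII, §3.16 eq. (renorm2) (arXiv:1212.5562v2 TeX L5859–5866)] -/
def locCoeff (𝒮 : Finset (Finset C)) (α : Finset C → R) (Λ : Finset C) (b : C) : R :=
  ∑ X ∈ 𝒮.filter (fun X => b ∈ X ∧ X ⊆ Λ), α X

/-- **The global coefficient at a cube**: `Σ_{X⊃□, X∈𝒮} α(E,X)` (= `−ε(E)`, `−½μ(E)`, `−ν_μ(E)` of part I — *"agree with
the global quantities which are denoted ε(E), μ(E), ν_μ(E)"*). [cite: Dimock2013BalabanII, §3.16 (arXiv:1212.5562v2 TeX L5868–5875); Dimock2013, §3.5 (renorm2) (arXiv:1108.1335v2 TeX L1802–1821)] -/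
def globCoeff (𝒮 : Finset (Finset C)) (α : Finset C → R) (b : C) : R :=
  ∑ X ∈ 𝒮.filter (fun X => b ∈ X), α X

/-! ## §2 (renorm2), «well inside», the boundary identity, (renorm3)∕(renorm5) for one relevant part -/

section OnePart

variable (𝒮 : Finset (Finset C)) (α : Finset C → R) (v : C → R) (Λ : Finset C)

/-- **(renorm2), localized**: *"Summing this over X ⊂ Λ we find E(Λ) = −Σ_{□⊂Λ} ε_Λ(E,□)Vol(□) − …"* — for one relevant
part, `Σ_{X∈𝒮, X⊆Λ} α(X)·V(X) = Σ_{□∈Λ} (Σ_{□⊂X⊂Λ, X∈𝒮} α(X))·v(□)` (exchange of the two finite sums). [cite: Dimock2013BalabanII, §3.16 eq. (renorm2) (arXiv:1212.5562v2 TeX L5846–5866)] -/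
theorem sum_small_inside_eq :
    ∑ X ∈ 𝒮.filter (· ⊆ Λ), α X * addV v X = ∑ b ∈ Λ, locCoeff 𝒮 α Λ b * v b := by
  unfold locCoeff addV
  simp_rw [Finset.mul_sum, Finset.sum_mul]
  refine Finset.sum_comm' fun X b => ?_
  simp only [mem_filter]
  constructor
  · rintro ⟨⟨hXS, hXΛ⟩, hbX⟩
    exact ⟨⟨hXS, hbX, hXΛ⟩, hXΛ hbX⟩
  · rintro ⟨⟨hXS, hbX, hXΛ⟩, _⟩
    exact ⟨⟨hXS, hXΛ⟩, hbX⟩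

/-- **«well inside»**: *"if □ is well inside Λ then X ∈ 𝒮 and X ⊃ □ imply X ⊂ Λ so we can drop the latter condition
from the sums"* — then the local coefficient at `□` IS the global one. [cite: Dimock2013BalabanII, §3.16 (arXiv:1212.5562v2 TeX L5868–5875)] -/
theorem locCoeff_eq_globCoeff_of_wellInside {b : C} (hwell : ∀ X ∈ 𝒮, b ∈ X → X ⊆ Λ) :
    locCoeff 𝒮 α Λ b = globCoeff 𝒮 α b := by
  unfold locCoeff globCoeff
  refine Finset.sum_congr (Finset.filter_congr fun X hX => ?_) fun _ _ => rfl
  exact ⟨fun h => h.1, fun h => ⟨h, hwell X hX h⟩⟩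

/-- `glob(□) − loc_Λ(□) = Σ_{X∈𝒮, X∋□, X⊄Λ} α(X)` (*"ε_Λ(E,□) − ε(E) = Σ_{X∈𝒮, X⊃□, X#Λ} α_0(E,X)"* at `□ ∈ Λ`).
[cite: Dimock2013BalabanII, §3.16 (arXiv:1212.5562v2 TeX L5887–5892)] -/
theorem globCoeff_sub_locCoeff (b : C) :
    globCoeff 𝒮 α b - locCoeff 𝒮 α Λ b = ∑ X ∈ 𝒮.filter (fun X => b ∈ X ∧ ¬ X ⊆ Λ), α X := by
  unfold globCoeff locCoeff
  have h := Finset.sum_filter_add_sum_filter_not (𝒮.filter fun X => b ∈ X) (fun X => X ⊆ Λ) α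
  rw [Finset.filter_filter, Finset.filter_filter] at h
  linear_combination -h

/-- **The boundary identity** — *"Σ_{□⊂Λ}(ε_Λ(E,□) − ε(E))Vol(□) = Σ_{□⊂Λ}(Σ_{X∈𝒮, X⊃□, X#Λ} α_0(E,X))Vol(□) = Σ_{X∈𝒮,
X#Λ} α_0(E,X)(Σ_{□⊂Λ∩X}Vol(□)) = Σ_{X∈𝒮, X#Λ} α_0(E,X)Vol(Λ ∩ X)"* (and *"Similarly"* for `‖φ‖²`, `∫φ∂φ`): for any cube
functional, `Σ_{□∈Λ}(glob − loc_Λ)(□)·v(□) = Σ_{X∈𝒮, X#Λ} α(X)·V(X ∩ Λ)`. [cite: Dimock2013BalabanII, §3.16 (arXiv:1212.5562v2 TeX L5887–5909)] -/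
theorem sum_sub_mul_eq_sum_crosses :
    ∑ b ∈ Λ, (globCoeff 𝒮 α b - locCoeff 𝒮 α Λ b) * v b
      = ∑ X ∈ 𝒮.filter (Crosses · Λ), α X * addV v (X ∩ Λ) := by
  simp_rw [globCoeff_sub_locCoeff, Finset.sum_mul]
  -- exchange the two sums: pairs (□ ∈ Λ, X ∈ 𝒮 with □ ∈ X ⊄ Λ) = pairs (X ∈ 𝒮 with X ⊄ Λ, □ ∈ X ∩ Λ)
  rw [Finset.sum_comm' (t' := 𝒮.filter fun X => ¬ X ⊆ Λ) (s' := fun X => X ∩ Λ) (h := fun b X => by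
    simp only [mem_filter, mem_inter]
    constructor
    · rintro ⟨hb, hXS, hbX, hXΛ⟩
      exact ⟨⟨hbX, hb⟩, hXS, hXΛ⟩
    · rintro ⟨⟨hbX, hb⟩, hXS, hXΛ⟩
      exact ⟨hb, hXS, hbX, hXΛ⟩)]
  unfold addV
  simp_rw [Finset.mul_sum]
  -- the `X ⊄ Λ` with `X ∩ Λ = ∅` contribute nothing
  symm
  refine Finset.sum_subset (fun X hX => ?_) fun X hX hXn => ?_
  · simp only [mem_filter] at hX ⊢
    exact ⟨hX.1, hX.2.2⟩
  · simp only [mem_filter, Crosses, not_and, not_not] at hX hXn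
    have hempty : X ∩ Λ = ∅ := Finset.not_nonempty_iff_eq_empty.1 (fun hne => hX.2 (hXn hX.1 hne))
    rw [hempty, Finset.sum_empty]

/-- **(renorm3) ∕ (renorm5) for one relevant part** — local = global − boundary:
`Σ_{X∈𝒮, X⊆Λ} α(X)·V(X) = Σ_{□∈Λ} glob(□)·v(□) − Σ_{X∈𝒮, X#Λ} α(X)·V(X ∩ Λ)` (the sign bookkeeping of the header's
reading (iii): with the printed `ε_Λ`, `ε`, `𝒯_Λ` the boundary sum enters with `−`). [cite: Dimock2013BalabanII, §3.16 eqs. (renorm3), (renorm5) (arXiv:1212.5562v2 TeX L5876–5921)] -/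
theorem sum_small_inside_eq_global_sub_bdry :
    ∑ X ∈ 𝒮.filter (· ⊆ Λ), α X * addV v X
      = ∑ b ∈ Λ, globCoeff 𝒮 α b * v b - ∑ X ∈ 𝒮.filter (Crosses · Λ), α X * addV v (X ∩ Λ) := by
  rw [sum_small_inside_eq, ← sum_sub_mul_eq_sum_crosses, ← Finset.sum_sub_distrib]
  exact Finset.sum_congr rfl fun b _ => by ring

/-- **Translation invariance**: if the global coefficient is the same constant `g` at every cube of `Λ` (*"independent
of □ and Λ and agree with the global quantities"*), the global part is `g·V(Λ)` (print: `−ε(E)Vol(Λ)`, `−½μ(E)‖φ‖²_Λ`,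
`−ν_μ(E)∫_Λφ∂_μφ = 0`). [cite: Dimock2013BalabanII, §3.16 (arXiv:1212.5562v2 TeX L5868–5881)] -/
theorem sum_globCoeff_mul_of_const {g : R} (hg : ∀ b ∈ Λ, globCoeff 𝒮 α b = g) :
    ∑ b ∈ Λ, globCoeff 𝒮 α b * v b = g * addV v Λ := by
  unfold addV
  rw [Finset.mul_sum]
  exact Finset.sum_congr rfl fun b hb => by rw [hg b hb]

end OnePart

/-! ## §3 The localized extraction with finitely many relevant parts: (renorm5) -/

section Assembly

variable {κ : Type*} [Fintype κ]
variable (𝒮 : Finset (Finset C)) (α : κ → Finset C → R) (v : κ → C → R) (RE E : Finset C → R) (Λ : Finset C)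

/-- **`𝒯_Λ E(X)`** — *"𝒯_Λ E(X, φ) = α_0(E,X)Vol(Λ ∩ X) + α_2(E,X)‖φ‖²_{X∩Λ} + Σ_μ α_{2,μ}(E,X)∫_{X∩Λ} φ ∂_μφ"*: the
relevant parts of a small polymer restricted to the region. [cite: Dimock2013BalabanII, §3.16 (arXiv:1212.5562v2 TeX L5910–5915)] -/
def bdryT (X : Finset C) : R := ∑ i, α i X * addV (v i) (X ∩ Λ)

/-- **THE LOCALIZED EXTRACTION** — *"suppose E(Λ) = Σ_{X⊂Λ} E(X) … E(Λ) = −ε(E)Vol(Λ) − ½μ(E)‖φ‖²_Λ + Σ_{X⊂Λ}(𝓡E)(X) +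
Σ_{X#Λ, X∈𝒮} 𝒯_Λ E(X) (renorm5)"*, with the □-dependence kept: if `E(X) = Σ_i α_i(X)·V_i(X) + 𝓡E(X)` for small `X` (the
extraction (renorm)) and `E(X) = 𝓡E(X)` for large `X`, then `Σ_{X⊆Λ} E(X) = Σ_i Σ_{□∈Λ} glob_i(□)·v_i(□) + Σ_{X⊆Λ} 𝓡E(X) −
Σ_{X∈𝒮, X#Λ} 𝒯_Λ E(X)` (`𝒮` = the small polymers). [cite: Dimock2013BalabanII, §3.16 eqs. (renorm2)–(renorm5) (arXiv:1212.5562v2 TeX L5822–5921)] -/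
theorem localized_extraction (small : Finset C → Prop) [DecidablePred small] (hmem : ∀ X, X ⊆ Λ → (X ∈ 𝒮 ↔ small X))
    (hE_small : ∀ X, small X → E X = (∑ i, α i X * addV (v i) X) + RE X)
    (hE_large : ∀ X, ¬ small X → E X = RE X) :
    ∑ X ∈ Λ.powerset, E X
      = (∑ i, ∑ b ∈ Λ, globCoeff 𝒮 (α i) b * v i b) + ∑ X ∈ Λ.powerset, RE X
          - ∑ X ∈ 𝒮.filter (Crosses · Λ), bdryT α v Λ X := by
  classical
  -- split every `E(X)` into its relevant parts (zero for large `X`) and `𝓡E(X)`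
  have hsplit : ∀ X, E X = (if small X then ∑ i, α i X * addV (v i) X else 0) + RE X := fun X => by
    by_cases h : small X
    · rw [if_pos h, hE_small X h]
    · rw [if_neg h, hE_large X h, zero_add]
  simp_rw [hsplit, Finset.sum_add_distrib, ← Finset.sum_filter]
  -- the small polymers inside `Λ`, as a filter of `𝒮`
  have hset : Λ.powerset.filter small = 𝒮.filter (· ⊆ Λ) := by
    ext X
    simp only [mem_filter, mem_powerset]
    constructor
    · rintro ⟨hXΛ, hX⟩; exact ⟨(hmem X hXΛ).2 hX, hXΛ⟩
    · rintro ⟨hX, hXΛ⟩; exact ⟨hXΛ, (hmem X hXΛ).1 hX⟩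
  rw [hset, Finset.sum_comm]
  simp_rw [sum_small_inside_eq_global_sub_bdry, Finset.sum_sub_distrib]
  unfold bdryT
  rw [Finset.sum_comm (s := 𝒮.filter (Crosses · Λ))]
  ring

/-- **(renorm5) in the translation-invariant case** (*"are independent of □ and Λ and agree with the global
quantities"*): `Σ_{X⊆Λ} E(X) = Σ_i g_i·V_i(Λ) + Σ_{X⊆Λ} 𝓡E(X) − Σ_{X∈𝒮, X#Λ} 𝒯_Λ E(X)` — print: `g_0V_0(Λ) = −ε(E)Vol(Λ)`,
`g_2V_2(Λ) = −½μ(E)‖φ‖²_Λ`, `g_{2,μ} = −ν_μ(E) = 0`; the header's reading (iii) records the overall sign of the boundary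
sum relative to the printed `+`. [cite: Dimock2013BalabanII, §3.16 eq. (renorm5) (arXiv:1212.5562v2 TeX L5868–5921)] -/
theorem localized_extraction_of_const (small : Finset C → Prop) [DecidablePred small]
    (hmem : ∀ X, X ⊆ Λ → (X ∈ 𝒮 ↔ small X))
    (hE_small : ∀ X, small X → E X = (∑ i, α i X * addV (v i) X) + RE X)
    (hE_large : ∀ X, ¬ small X → E X = RE X) {g : κ → R}
    (hg : ∀ i, ∀ b ∈ Λ, globCoeff 𝒮 (α i) b = g i) :
    ∑ X ∈ Λ.powerset, E X
      = (∑ i, g i * addV (v i) Λ) + ∑ X ∈ Λ.powerset, RE X - ∑ X ∈ 𝒮.filter (Crosses · Λ), bdryT α v Λ X := by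
  rw [localized_extraction 𝒮 α v RE E Λ small hmem hE_small hE_large]
  congr 2
  exact Finset.sum_congr rfl fun i _ => sum_globCoeff_mul_of_const 𝒮 (α i) (v i) Λ (hg i)

end Assembly

/-! ## §4 Non-vacuity -/

/-- Three cubes in a row, small polymers = the two adjacent pairs, region `Λ = {0,1}`, constant coefficient `1` and
volume `1` per cube: the small polymer inside `Λ` is `{0,1}` (value `2`); globally each cube of `Λ` sees `{0,1}` and
cube `1` also sees `{1,2}` (`1 + 2 = 3`); the crossing polymer `{1,2}` gives back `V({1,2} ∩ Λ) = 1`: `2 = 3 − 1`. -/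
example :
    ∑ X ∈ ({({0, 1} : Finset (Fin 3)), {1, 2}} : Finset (Finset (Fin 3))).filter (· ⊆ ({0, 1} : Finset (Fin 3))),
        (1 : ℤ) * addV (fun _ => (1 : ℤ)) X
      = ∑ b ∈ ({0, 1} : Finset (Fin 3)), globCoeff ({({0, 1} : Finset (Fin 3)), {1, 2}}) (fun _ => (1 : ℤ)) b * 1
        - ∑ X ∈ ({({0, 1} : Finset (Fin 3)), {1, 2}} : Finset (Finset (Fin 3))).filter
            (Crosses · ({0, 1} : Finset (Fin 3))), (1 : ℤ) * addV (fun _ => (1 : ℤ)) (X ∩ {0, 1}) :=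
  sum_small_inside_eq_global_sub_bdry _ _ _ _

example : ∑ X ∈ ({({0, 1} : Finset (Fin 3)), {1, 2}} : Finset (Finset (Fin 3))).filter
    (· ⊆ ({0, 1} : Finset (Fin 3))), (1 : ℤ) * addV (fun _ => (1 : ℤ)) X = 2 := by decide

end Literature.MathematicalPhysics.QuantumFieldTheory.Dimock2011to13.LocalizedExtraction
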